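import Literature.NumberTheory.EllipticCurves.UniformizationUniqueProofs
import Mathlib.Analysis.Calculus.Deriv.Shift
import Mathlib.Analysis.Calculus.MeanValue
import HarnessLib

/-!
# The zeros of `℘'` are the half-periods

Auxiliary results on the Weierstrass function of an arbitrary period pair `L` (Mathlib
`PeriodPair`, `℘ = ℘[L]`, `℘' = ℘'[L]`), used in the discharge of the named facts of
`Literature/NumberTheory/EllipticCurves/RealLatticePeriod.lean` on the bounded real component
(`RealLatticePeriodDiscrProofs.lean`):

* `PeriodPair.hasDerivAt_derivWeierstrassP` : `℘'' = 6℘² − g₂/2` off the lattice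
  (Whittaker–Watson §20.22), obtained by differentiating Mathlib's
  `PeriodPair.derivWeierstrassP_sq : ℘'² = 4℘³ − g₂℘ − g₃` and cancelling `℘'`, which does not
  vanish identically near any point (`not_eventually_derivWeierstrassP_eq_zero`, else `℘` would be
  constant on the connected set `ℂ ∖ Λ` and bounded at `0`);
* `PeriodPair.eventuallyEq_of_deriv_deriv_eq` : uniqueness for the analytic initial value
  problem `w'' = 6w² − c` (leading-term argument on the difference);
* `PeriodPair.two_mul_mem_lattice_of_derivWeierstrassP_eq_zero` : if `z₀ ∉ Λ` and `℘'(z₀) = 0`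
  then `2z₀ ∈ Λ` (Whittaker–Watson §20.32: "`℘'` is an odd elliptic function of order 3 whose
  zeros are the half-periods"; Lawden §6.7).  Instead of counting zeros in a period
  parallelogram (not available in Mathlib) we argue: `℘(z₀ + z)` and `℘(z₀ − z)` solve the same
  initial value problem, so `℘(z₀ + z) = ℘(z₀ − z)` on the connected complement of a countable
  set; letting `z → z₀` the right side blows up (`order_weierstrassP`), so `2z₀ ∈ Λ`.

## References

* E. T. Whittaker, G. N. Watson, *A Course of Modern Analysis*, §20.22, §20.32.
* D. F. Lawden, *Elliptic Functions and Applications*, Applied Math. Sciences 80, Springer 1989,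
  §6.7.
-/

noncomputable section

open scoped Topology
open Filter Set Complex

namespace PeriodPair

variable (L : PeriodPair)

/-! ### `℘'' = 6℘² − g₂/2` -/

/-- The complement of a lattice is preconnected. [folklore] -/
lemma isPreconnected_compl_lattice : IsPreconnected ((L.lattice : Set ℂ)ᶜ) :=
  (Set.Countable.isConnected_compl_of_one_lt_rank (by simp) L.countable_lattice).isPreconnected

/-- `℘` does not tend to a finite limit at `0` (double pole). [folklore] -/
lemma not_tendsto_weierstrassP_nhdsNE_zero (c : ℂ) : ¬ Tendsto ℘[L] (𝓝[≠] 0) (𝓝 c) := by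
  intro h
  have h0 := (tendsto_nhds_iff_meromorphicOrderAt_nonneg (L.meromorphic_weierstrassP 0)).mp ⟨c, h⟩
  rw [L.order_weierstrassP 0 (zero_mem _)] at h0
  exact absurd h0 (by decide)

/-- `℘'` does not vanish identically near any non-lattice point. [folklore] -/
lemma not_eventually_derivWeierstrassP_eq_zero {z : ℂ} (hz : z ∉ L.lattice) :
    ¬ (∀ᶠ w in 𝓝 z, ℘'[L] w = 0) := by
  intro h
  -- `℘' = 0` on the connected open set `Λᶜ`
  have hall : EqOn ℘'[L] 0 ((L.lattice : Set ℂ)ᶜ) :=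
    L.analyticOnNhd_derivWeierstrassP.eqOn_zero_of_preconnected_of_eventuallyEq_zero
      L.isPreconnected_compl_lattice hz h
  -- so `℘` is constant on `Λᶜ`
  obtain ⟨a, ha⟩ := L.isClosed_lattice.isOpen_compl.exists_is_const_of_deriv_eq_zero
    L.isPreconnected_compl_lattice L.differentiableOn_weierstrassP
    (fun w hw ↦ by rw [L.deriv_weierstrassP]; exact hall hw)
  -- and tends to `a` at `0`: impossible
  refine L.not_tendsto_weierstrassP_nhdsNE_zero a (tendsto_nhds_of_eventually_eq ?_)
  filter_upwards [L.eventually_nhdsNE_notMem_lattice] with w hw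
  exact ha w hw

/-- **Second-order equation** `℘'' = 6℘² − g₂/2` off the lattice (derivative of
`℘'² = 4℘³ − g₂℘ − g₃`, Whittaker–Watson §20.22). [folklore] -/
theorem hasDerivAt_derivWeierstrassP {z : ℂ} (hz : z ∉ L.lattice) :
    HasDerivAt ℘'[L] (6 * ℘[L] z ^ 2 - L.g₂ / 2) z := by
  -- `℘' · (2 ℘'' − 12 ℘² + g₂) = 0` on `Λᶜ`
  have key : ∀ w ∉ L.lattice,
      ℘'[L] w * (2 * deriv ℘'[L] w - 12 * ℘[L] w ^ 2 + L.g₂) = 0 := by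
    intro w hw
    have hnhds : ((L.lattice : Set ℂ)ᶜ) ∈ 𝓝 w := L.isClosed_lattice.isOpen_compl.mem_nhds hw
    have hP : HasDerivAt ℘[L] (℘'[L] w) w := by
      have hd : DifferentiableAt ℂ ℘[L] w := L.differentiableOn_weierstrassP.differentiableAt hnhds
      simpa using hd.hasDerivAt
    have hP' : HasDerivAt ℘'[L] (deriv ℘'[L] w) w :=
      (L.differentiableOn_derivWeierstrassP.differentiableAt hnhds).hasDerivAt
    -- the relation `℘'² − 4℘³ + g₂℘ + g₃` vanishes near `w`
    have hR0 : (fun x ↦ ℘'[L] x ^ 2 - 4 * ℘[L] x ^ 3 + L.g₂ * ℘[L] x + L.g₃) =ᶠ[𝓝 w]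
        fun _ ↦ (0 : ℂ) := by
      filter_upwards [hnhds] with x hx
      simp only [L.derivWeierstrassP_sq x hx]
      ring
    have hRd : HasDerivAt (fun x ↦ ℘'[L] x ^ 2 - 4 * ℘[L] x ^ 3 + L.g₂ * ℘[L] x + L.g₃)
        (((2 : ℕ) : ℂ) * ℘'[L] w ^ (2 - 1) * deriv ℘'[L] w -
          4 * (((3 : ℕ) : ℂ) * ℘[L] w ^ (3 - 1) * ℘'[L] w) + L.g₂ * ℘'[L] w) w :=
      (((hP'.fun_pow 2).fun_sub ((hP.fun_pow 3).const_mul 4)).fun_add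
        (hP.const_mul L.g₂)).add_const L.g₃
    have hd0 := hRd.deriv
    rw [hR0.deriv_eq, deriv_const] at hd0
    push_cast at hd0
    linear_combination -hd0
  have hnhds : ((L.lattice : Set ℂ)ᶜ) ∈ 𝓝 z := L.isClosed_lattice.isOpen_compl.mem_nhds hz
  have hP'a : AnalyticAt ℂ ℘'[L] z := L.analyticOnNhd_derivWeierstrassP z hz
  have hP' : HasDerivAt ℘'[L] (deriv ℘'[L] z) z :=
    (L.differentiableOn_derivWeierstrassP.differentiableAt hnhds).hasDerivAt
  suffices h : 2 * deriv ℘'[L] z - 12 * ℘[L] z ^ 2 + L.g₂ = 0 by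
    convert hP' using 1
    linear_combination -h / 2
  -- the continuous function `H = 2℘'' − 12℘² + g₂` vanishes on a punctured neighbourhood of `z`
  set H : ℂ → ℂ := fun w ↦ 2 * deriv ℘'[L] w - 12 * ℘[L] w ^ 2 + L.g₂ with hH
  have hHc : ContinuousAt H z := by
    have h1 : ContinuousAt (deriv ℘'[L]) z := hP'a.deriv.continuousAt
    have h2 : ContinuousAt ℘[L] z := (L.analyticOnNhd_weierstrassP z hz).continuousAt
    simp only [hH]
    fun_prop
  have hH0 : H =ᶠ[𝓝[≠] z] 0 := by
    have h1 := (hP'a.eventually_eq_zero_or_eventually_ne_zero).resolve_left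
      (L.not_eventually_derivWeierstrassP_eq_zero hz)
    filter_upwards [h1, mem_nhdsWithin_of_mem_nhds hnhds] with w hw1 hw2
    have := key w hw2
    simp only [hH, Pi.zero_apply]
    exact (mul_eq_zero.mp this).resolve_left hw1
  have : H z = 0 :=
    tendsto_nhds_unique_of_eventuallyEq (hHc.tendsto.mono_left nhdsWithin_le_nhds)
      tendsto_const_nhds hH0
  simpa [hH] using this

/-- `deriv ℘' = 6℘² − g₂/2` off the lattice. [folklore] -/
theorem deriv_derivWeierstrassP {z : ℂ} (hz : z ∉ L.lattice) :
    deriv ℘'[L] z = 6 * ℘[L] z ^ 2 - L.g₂ / 2 :=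
  (L.hasDerivAt_derivWeierstrassP hz).deriv

/-! ### Uniqueness for the analytic initial value problem `w'' = 6w² − c` -/

/-- **Analytic uniqueness for `w'' = 6w² − c`.**  Two functions analytic at `0` satisfying
`w'' = 6w² − c` near `0` with the same value and derivative at `0` agree near `0`
(leading-term argument on `d = w₁ − w₂`, `d'' = 6(w₁ + w₂)d`). [folklore] -/
theorem eventuallyEq_of_deriv_deriv_eq {w₁ w₂ : ℂ → ℂ} {c : ℂ} (h₁ : AnalyticAt ℂ w₁ 0)
    (h₂ : AnalyticAt ℂ w₂ 0) (hode₁ : ∀ᶠ z in 𝓝 0, deriv (deriv w₁) z = 6 * w₁ z ^ 2 - c)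
    (hode₂ : ∀ᶠ z in 𝓝 0, deriv (deriv w₂) z = 6 * w₂ z ^ 2 - c) (h0 : w₁ 0 = w₂ 0)
    (h0' : deriv w₁ 0 = deriv w₂ 0) : w₁ =ᶠ[𝓝 0] w₂ := by
  set d : ℂ → ℂ := fun z ↦ w₁ z - w₂ z with hd
  have hda : AnalyticAt ℂ d 0 := h₁.sub h₂
  have hd0 : d 0 = 0 := by simp [hd, h0]
  -- `deriv d = w₁' - w₂'` near `0`, `deriv (deriv d) = 6 (w₁ + w₂) d` near `0`
  have hdd : deriv d =ᶠ[𝓝 0] fun z ↦ deriv w₁ z - deriv w₂ z := by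
    filter_upwards [h₁.eventually_analyticAt, h₂.eventually_analyticAt] with z hz1 hz2
    exact deriv_fun_sub hz1.differentiableAt hz2.differentiableAt
  have hdd0 : deriv d 0 = 0 := by
    have := hdd.self_of_nhds
    simp only at this
    rw [this, h0', sub_self]
  have hddd : deriv (deriv d) =ᶠ[𝓝 0] fun z ↦ 6 * (w₁ z + w₂ z) * d z := by
    have h1 : deriv (deriv d) =ᶠ[𝓝 0] deriv (fun z ↦ deriv w₁ z - deriv w₂ z) := hdd.deriv
    filter_upwards [h1, h₁.eventually_analyticAt, h₂.eventually_analyticAt, hode₁, hode₂]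
      with z hz hz1 hz2 hz3 hz4
    rw [hz, deriv_fun_sub hz1.deriv.differentiableAt hz2.deriv.differentiableAt, hz3, hz4, hd]
    ring
  suffices htop : analyticOrderAt d 0 = ⊤ by
    rw [analyticOrderAt_eq_top] at htop
    filter_upwards [htop] with z hz
    exact sub_eq_zero.mp hz
  by_contra hne
  obtain ⟨n, hn⟩ := ENat.ne_top_iff_exists.mp hne
  obtain ⟨g, hga, hg0, hdg⟩ := hda.analyticOrderAt_eq_natCast.mp hn.symm
  simp only [sub_zero, smul_eq_mul] at hdg
  -- `n ≥ 2`
  obtain ⟨m, rfl⟩ : ∃ m, n = m + 2 := by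
    rcases Nat.lt_or_ge n 2 with hn2 | hn2
    · exfalso
      interval_cases n
      · have h := hdg.self_of_nhds
        rw [hd0, pow_zero, one_mul] at h
        exact hg0 h.symm
      · have h1 : deriv d =ᶠ[𝓝 0] deriv (fun z ↦ z ^ 1 * g z) :=
          (show d =ᶠ[𝓝 0] fun z ↦ z ^ 1 * g z from hdg).deriv
        have h2 := h1.self_of_nhds
        have e1 : HasDerivAt (fun z ↦ z ^ 1 * g z)
            ((((1 : ℕ) : ℂ) * (0 : ℂ) ^ (1 - 1)) * g 0 + (0 : ℂ) ^ 1 * deriv g 0) 0 :=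
          (hasDerivAt_pow 1 (0 : ℂ)).fun_mul hga.differentiableAt.hasDerivAt
        rw [hdd0, e1.deriv] at h2
        simp at h2
        exact hg0 h2.symm
    · exact ⟨n - 2, by omega⟩
  -- second derivative of `z^{m+2} g`
  have hga' : ∀ᶠ z in 𝓝 0, AnalyticAt ℂ g z := hga.eventually_analyticAt
  have hd1 : deriv d =ᶠ[𝓝 0] fun z ↦ (m + 2 : ℕ) * z ^ (m + 1) * g z + z ^ (m + 2) * deriv g z := by
    have h1 : deriv d =ᶠ[𝓝 0] deriv (fun z ↦ z ^ (m + 2) * g z) :=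
      (show d =ᶠ[𝓝 0] fun z ↦ z ^ (m + 2) * g z from hdg).deriv
    filter_upwards [h1, hga'] with z hz hgz
    rw [hz, deriv_fun_mul (differentiableAt_pow _) hgz.differentiableAt, deriv_pow_field]
    simp
  have hd2 : deriv (deriv d) =ᶠ[𝓝 0] fun z ↦ z ^ m * (((m + 2) * (m + 1) : ℕ) * g z +
      2 * (m + 2 : ℕ) * z * deriv g z + z ^ 2 * deriv (deriv g) z) := by
    have h1 : deriv (deriv d) =ᶠ[𝓝 0]
        deriv (fun z ↦ (m + 2 : ℕ) * z ^ (m + 1) * g z + z ^ (m + 2) * deriv g z) := hd1.deriv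
    filter_upwards [h1, hga'] with z hz hgz
    rw [hz]
    have e1 : HasDerivAt (fun z ↦ (m + 2 : ℕ) * z ^ (m + 1) * g z)
        ((m + 2 : ℕ) * (((m + 1 : ℕ) : ℂ) * z ^ (m + 1 - 1)) * g z +
          (m + 2 : ℕ) * z ^ (m + 1) * deriv g z) z :=
      ((hasDerivAt_pow (m + 1) z).const_mul ((m + 2 : ℕ) : ℂ)).fun_mul
        hgz.differentiableAt.hasDerivAt
    have e2 : HasDerivAt (fun z ↦ z ^ (m + 2) * deriv g z)
        ((((m + 2 : ℕ) : ℂ) * z ^ (m + 2 - 1)) * deriv g z + z ^ (m + 2) * deriv (deriv g) z) z :=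
      (hasDerivAt_pow (m + 2) z).fun_mul hgz.deriv.differentiableAt.hasDerivAt
    rw [(e1.fun_add e2).deriv, show m + 1 - 1 = m from rfl, show m + 2 - 1 = m + 1 from rfl]
    push_cast
    ring
  -- compare the two expressions for `d''` on a punctured neighbourhood and let `z → 0`
  set F : ℂ → ℂ := fun z ↦ ((m + 2) * (m + 1) : ℕ) * g z +
      2 * (m + 2 : ℕ) * z * deriv g z + z ^ 2 * deriv (deriv g) z with hF
  set G : ℂ → ℂ := fun z ↦ 6 * (w₁ z + w₂ z) * (z ^ 2 * g z) with hG
  have hFG : F =ᶠ[𝓝[≠] 0] G := by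
    filter_upwards [mem_nhdsWithin_of_mem_nhds hddd, mem_nhdsWithin_of_mem_nhds hd2,
      mem_nhdsWithin_of_mem_nhds hdg, self_mem_nhdsWithin] with z h1 h2 h3 hz0
    replace hz0 : z ≠ 0 := hz0
    have key : z ^ m * F z = z ^ m * G z := by
      rw [hF, hG]
      simp only
      rw [← h2, h1, h3]
      ring
    exact mul_left_cancel₀ (pow_ne_zero _ hz0) key
  have hFc : ContinuousAt F 0 := by
    have := hga.continuousAt; have := hga.deriv.continuousAt; have := hga.deriv.deriv.continuousAt
    simp only [hF]
    fun_prop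
  have hGc : ContinuousAt G 0 := by
    have := hga.continuousAt; have := h₁.continuousAt; have := h₂.continuousAt
    simp only [hG]
    fun_prop
  have hlim : F 0 = G 0 :=
    tendsto_nhds_unique_of_eventuallyEq (hFc.tendsto.mono_left nhdsWithin_le_nhds)
      (hGc.tendsto.mono_left nhdsWithin_le_nhds) hFG
  simp only [hF, hG] at hlim
  norm_num at hlim
  rcases hlim with h | h
  · norm_cast at h
  · exact hg0 h

/-! ### Critical points of `℘` are half-periods -/

/-- **The zeros of `℘'` are half-periods**: if `z₀ ∉ Λ` and `℘'(z₀) = 0` then `2z₀ ∈ Λ`.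
Proof: `℘(z₀ + z)` and `℘(z₀ − z)` solve the same analytic initial value problem
`w'' = 6w² − g₂/2`, `w(0) = ℘(z₀)`, `w'(0) = 0`, so `℘(z₀ + z) = ℘(z₀ − z)`; at `z → z₀` the right
side has a pole, so the left side has one at `2z₀`.  (Classically: `℘'` is odd of order `3` with
zeros at the three half-periods; Whittaker–Watson §20.32, Lawden §6.7.) [folklore] -/
theorem two_mul_mem_lattice_of_derivWeierstrassP_eq_zero {z₀ : ℂ} (hz₀ : z₀ ∉ L.lattice)
    (h : ℘'[L] z₀ = 0) : 2 * z₀ ∈ L.lattice := by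
  by_contra h2
  -- the two solutions
  set w₁ : ℂ → ℂ := fun z ↦ ℘[L] (z₀ + z) with hw₁
  set w₂ : ℂ → ℂ := fun z ↦ ℘[L] (z₀ - z) with hw₂
  have hPa : AnalyticAt ℂ ℘[L] z₀ := L.analyticOnNhd_weierstrassP z₀ hz₀
  have h₁ : AnalyticAt ℂ w₁ 0 := by
    have : AnalyticAt ℂ ℘[L] (z₀ + 0) := by simpa using hPa
    exact this.comp (analyticAt_const.add analyticAt_id)
  have h₂ : AnalyticAt ℂ w₂ 0 := by
    have : AnalyticAt ℂ ℘[L] (z₀ - 0) := by simpa using hPa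
    exact this.comp (analyticAt_const.sub analyticAt_id)
  have hopen : IsOpen ((L.lattice : Set ℂ)ᶜ) := L.isClosed_lattice.isOpen_compl
  have hca : Continuous fun z : ℂ ↦ z₀ + z := by fun_prop
  have hcs : Continuous fun z : ℂ ↦ z₀ - z := by fun_prop
  have hev₁ : ∀ᶠ z in 𝓝 (0 : ℂ), z₀ + z ∉ L.lattice := by
    have : Tendsto (fun z : ℂ ↦ z₀ + z) (𝓝 0) (𝓝 z₀) := by
      simpa using hca.tendsto (0 : ℂ)
    exact this.eventually (hopen.mem_nhds hz₀)
  have hev₂ : ∀ᶠ z in 𝓝 (0 : ℂ), z₀ - z ∉ L.lattice := by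
    have : Tendsto (fun z : ℂ ↦ z₀ - z) (𝓝 0) (𝓝 z₀) := by
      simpa using hcs.tendsto (0 : ℂ)
    exact this.eventually (hopen.mem_nhds hz₀)
  have hd₁ : deriv w₁ = fun z ↦ ℘'[L] (z₀ + z) := by
    ext z; rw [hw₁, deriv_comp_const_add, L.deriv_weierstrassP]
  have hd₂ : deriv w₂ = fun z ↦ -℘'[L] (z₀ - z) := by
    ext z; rw [hw₂, deriv_comp_const_sub, L.deriv_weierstrassP]
  have hode₁ : ∀ᶠ z in 𝓝 0, deriv (deriv w₁) z = 6 * w₁ z ^ 2 - L.g₂ / 2 := by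
    filter_upwards [hev₁] with z hz
    rw [hd₁]
    rw [deriv_comp_const_add (f := ℘'[L]), L.deriv_derivWeierstrassP hz]
  have hode₂ : ∀ᶠ z in 𝓝 0, deriv (deriv w₂) z = 6 * w₂ z ^ 2 - L.g₂ / 2 := by
    filter_upwards [hev₂] with z hz
    rw [hd₂, deriv.fun_neg, deriv_comp_const_sub (f := ℘'[L]), L.deriv_derivWeierstrassP hz]
    ring
  have hloc : w₁ =ᶠ[𝓝 0] w₂ :=
    eventuallyEq_of_deriv_deriv_eq h₁ h₂ hode₁ hode₂ (by simp [hw₁, hw₂])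
      (by rw [hd₁, hd₂]; simp [h])
  -- analytic continuation to `V = {z | z₀ ± z ∉ Λ}`
  set V : Set ℂ := {z | z₀ + z ∉ L.lattice ∧ z₀ - z ∉ L.lattice} with hV
  have hVc : Vᶜ.Countable := by
    have : Vᶜ = (fun z ↦ z₀ + z) ⁻¹' (L.lattice : Set ℂ) ∪
        (fun z ↦ z₀ - z) ⁻¹' (L.lattice : Set ℂ) := by
      ext z; simp [hV, or_iff_not_and_not]
    rw [this]
    exact (L.countable_lattice.preimage (add_right_injective z₀)).union
      (L.countable_lattice.preimage sub_right_injective)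
  have hVconn : IsPreconnected V := by
    have := (Set.Countable.isConnected_compl_of_one_lt_rank (by simp) hVc).isPreconnected
    rwa [compl_compl] at this
  have hw₁a : AnalyticOnNhd ℂ w₁ V := fun z hz ↦
    (L.analyticOnNhd_weierstrassP _ hz.1).comp (analyticAt_const.add analyticAt_id)
  have hw₂a : AnalyticOnNhd ℂ w₂ V := fun z hz ↦
    (L.analyticOnNhd_weierstrassP _ hz.2).comp (analyticAt_const.sub analyticAt_id)
  have hV0 : (0 : ℂ) ∈ V := by simp [hV, hz₀]
  have hglob : EqOn w₁ w₂ V := hw₁a.eqOn_of_preconnected_of_eventuallyEq hw₂a hVconn hV0 hloc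
  -- near `z = z₀`: `℘(z₀ - z) = ℘(z₀ + z) → ℘(2z₀)`
  have hevV : ∀ᶠ z in 𝓝[≠] z₀, z ∈ V := by
    have h1 : ∀ᶠ z in 𝓝 z₀, z₀ + z ∉ L.lattice := by
      have : Tendsto (fun z : ℂ ↦ z₀ + z) (𝓝 z₀) (𝓝 (2 * z₀)) := by
        simpa [two_mul] using hca.tendsto z₀
      exact this.eventually (hopen.mem_nhds h2)
    have h2' : ∀ᶠ z in 𝓝[≠] z₀, z₀ - z ∉ L.lattice := by
      have ht : Tendsto (fun z : ℂ ↦ z₀ - z) (𝓝[≠] z₀) (𝓝[≠] 0) := by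
        refine tendsto_nhdsWithin_of_tendsto_nhds_of_eventually_within _ ?_ ?_
        · simpa using (hcs.tendsto z₀).mono_left nhdsWithin_le_nhds
        · filter_upwards [self_mem_nhdsWithin] with z hz
          simpa [sub_eq_zero, eq_comm] using hz
      exact ht.eventually L.eventually_nhdsNE_notMem_lattice
    filter_upwards [mem_nhdsWithin_of_mem_nhds h1, h2'] with z hz1 hz2
    exact ⟨hz1, hz2⟩
  have hlim₁ : Tendsto w₁ (𝓝[≠] z₀) (𝓝 (℘[L] (2 * z₀))) := by
    have hc : ContinuousAt w₁ z₀ := by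
      have : ContinuousAt ℘[L] (z₀ + z₀) := by
        rw [← two_mul]; exact (L.analyticOnNhd_weierstrassP _ h2).continuousAt
      exact this.comp hca.continuousAt
    have := hc.tendsto
    simp only [hw₁, ← two_mul] at this
    exact this.mono_left nhdsWithin_le_nhds
  have hlim₂ : Tendsto w₂ (𝓝[≠] z₀) (𝓝 (℘[L] (2 * z₀))) :=
    hlim₁.congr' (by filter_upwards [hevV] with z hz; exact hglob hz)
  -- hence `℘` tends to `℘(2z₀)` at `0`: contradiction with the pole
  have hback : Tendsto (fun z : ℂ ↦ z₀ - z) (𝓝[≠] 0) (𝓝[≠] z₀) := by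
    refine tendsto_nhdsWithin_of_tendsto_nhds_of_eventually_within _ ?_ ?_
    · simpa using (hcs.tendsto (0 : ℂ)).mono_left nhdsWithin_le_nhds
    · filter_upwards [self_mem_nhdsWithin] with z hz
      simpa using hz
  have : Tendsto ℘[L] (𝓝[≠] 0) (𝓝 (℘[L] (2 * z₀))) := by
    have := hlim₂.comp hback
    simpa [hw₂, Function.comp_def] using this
  exact L.not_tendsto_weierstrassP_nhdsNE_zero _ this

end PeriodPair

end
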